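import Summits.Ventures.Crystal3D.Theorems.StickyWulffConstantCoaxialWallLawEisensteinDescent
import Summits.Ventures.Crystal3D.Theorems.StickyWulffConstantGenericWallFloorStackWalkRigidity
import Summits.Ventures.Crystal3D.Theorems.StickyWulffConstantNoReconstructionGainSymmetry
import Summits.Ventures.Crystal3D.Theorems.StickyWulffConstantCoaxialWallLawTriadic
import Summits.Ventures.Crystal3D.Theorems.StickyWulffConstantGenericWallFloorMixedDozenRules
import Summits.Ventures.Crystal3D.StickySpheres.FccCubeFacetNoGain
import HarnessLib

/-!
# Twin-chain lattices are `3⁻ᵏ`-integral, and their in-plane unit vectors are UNTWISTED (hexagon rigidity)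

HONEST FRAMING. Venture `Summits/Ventures/Crystal3D` (cell `crystal3d-full`); helper `--supports` the crux `CoaxialWallLaw` (stmt-Ventures-19481):
census-free lattice algebra behind lane T's `stub_famOffFamily` ((F2) of HOME/wall-19481-p1/g17/FAMOFF-SIZING-g17.md: «a Σ3ⁿ-relative sharing the threefold axis
is the lattice or its basal twin»), the BothFaulted slab-registry line ((R-b): «the far face of a crossed lamella is parallel»), and the reader-local form of
`TailResidue.LocalBarlowRigidity` (junction exclusion).  Nothing about the crux is claimed; F-C1 not moved.

SETTING.  `wordFrame B κ = B ∘ R_{μ_k} ∘ ⋯ ∘ R_{μ₁}` (…StackWalkRigidity) for a list `κ` of unit MODEL menu normals `μ` of `Λ₀ = fccStacking 1 √(2/3)`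
(`∀ w ∈ fccSlots, ⟪w, μ⟫ ∈ {0, ±√(2/3)}`): the frame reached from `B` by `k = |κ|` coherent `{111}` twins (no reducedness is needed in this file).
* `wordFrame_eq_trans` — `wordFrame B κ = (wordFrame 1 κ).trans B` (the model word acts first);
* `three_pow_smul_reflect_mem` — one model mirror costs one factor `3`: `3ʲ·x ∈ Λ₀ ⇒ 3ʲ⁺¹·R_μ x ∈ Λ₀` (`R_μ x = x − ⅓⟪x, √6μ⟫·√6μ`, `√6 μ ∈ Λ₀`,
  `⟪Λ₀, √6μ⟫ ⊆ ℤ` — `sqrt6_smul_menuNormal_mem`);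
* `three_pow_smul_wordFrame_mem` — **`3^|κ| · (wordFrame 1 κ x) ∈ Λ₀` for `x ∈ Λ₀`** (twin-chain lattices are `3⁻ᵏ`-integral);
* `mem_fcc_of_inplane_of_smul_mem` — **NO TWIST**: a UNIT vector `y` in the basal plane (`y 2 = 0`) with `3ᵏ·y ∈ Λ₀` is itself in `Λ₀` (hence a slot):
  `3ᵏ y = i u + j v` with `i² + ij + j² = 9ᵏ`, and Eisenstein descent (`pow_dvd_of_normForm_eq`) gives `3ᵏ ∣ i, j`;
* **`wordFrame_inplane_mem_fccSlots`** — for every word `κ` of unit model menu normals and every slot `w`, if `wordFrame 1 κ w` lies in the basal plane then it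
  is one of the six in-plane SLOTS of `Λ₀`: the hexagon of a twin-chain lattice sharing the axis `e₃` is the hexagon of `Λ₀` (no Σ7/Σ13/… twist inside Σ3ⁿ);
  `wordFrame_inplane_mem_image_fccSlots` — the same over any base frame `B` (axis `B e₃`).
WHAT THIS IS NOT: the full axis statement («`B e₃` a menu normal of `wordFrame B κ`, `κ` reduced ⇒ `κ ∈ {[], [±e₃]}`») needs, on top of this file, the dozen
dichotomy (hexagon ⇒ lattice or basal twin) and `map_reflection_eq_of_image_eq`; not done here.  F-C1 not moved.
-/

noncomputable section

namespace Summit.Ventures.Crystal3D.Theorems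

open Summit.Ventures.Crystal3D Finset
open Literature.MathematicalPhysics.StatisticalMechanics (barlowPos fccStacking constHagg barlowPos_apply_two barlowPos_mem
  mem_barlowStacking_iff)
open scoped InnerProductSpace

/-- The model word acts first: `wordFrame B κ = (wordFrame 1 κ).trans B`. -/
theorem wordFrame_eq_trans (B : EuclideanSpace ℝ (Fin 3) ≃ₗᵢ[ℝ] EuclideanSpace ℝ (Fin 3)) :
    ∀ κ : List (EuclideanSpace ℝ (Fin 3)),
      wordFrame B κ = (wordFrame (LinearIsometryEquiv.refl ℝ (EuclideanSpace ℝ (Fin 3))) κ).trans B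
  | [] => by ext x; rfl
  | μ :: κ => by
    rw [wordFrame_cons, wordFrame_cons, wordFrame_eq_trans B κ]; rfl

/-- Pointwise form of `wordFrame_eq_trans`. -/
theorem wordFrame_apply_eq (B : EuclideanSpace ℝ (Fin 3) ≃ₗᵢ[ℝ] EuclideanSpace ℝ (Fin 3))
    (κ : List (EuclideanSpace ℝ (Fin 3))) (x : EuclideanSpace ℝ (Fin 3)) :
    wordFrame B κ x = B (wordFrame (LinearIsometryEquiv.refl ℝ (EuclideanSpace ℝ (Fin 3))) κ x) := by
  rw [wordFrame_eq_trans B κ]; rfl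

/-- **One model mirror costs one factor `3`.**  For a unit menu normal `μ` of `Λ₀`: `3ʲ·x ∈ Λ₀ ⇒ 3ʲ⁺¹·(R_μ x) ∈ Λ₀`. -/
theorem three_pow_smul_reflect_mem {μ : EuclideanSpace ℝ (Fin 3)} (hμ : ‖μ‖ = 1)
    (hmenu : ∀ w ∈ fccSlots, ⟪w, μ⟫_ℝ = 0 ∨ ⟪w, μ⟫_ℝ = Real.sqrt (2 / 3) ∨ ⟪w, μ⟫_ℝ = -Real.sqrt (2 / 3))
    {x : EuclideanSpace ℝ (Fin 3)} {j : ℕ} (hx : ((3 : ℝ) ^ j) • x ∈ fccStacking 1 (Real.sqrt (2 / 3))) :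
    ((3 : ℝ) ^ (j + 1)) • ((ℝ ∙ μ)ᗮ.reflection x) ∈ fccStacking 1 (Real.sqrt (2 / 3)) := by
  obtain ⟨ht, hint⟩ := sqrt6_smul_menuNormal_mem hμ hmenu
  obtain ⟨z, hz⟩ := hint _ hx
  have h66 : Real.sqrt 6 * Real.sqrt 6 = 6 := Real.mul_self_sqrt (by norm_num)
  -- 3^(j+1) R_μ x = 3 · (3^j x) − z · (√6 μ)
  have e : ((3 : ℝ) ^ (j + 1)) • ((ℝ ∙ μ)ᗮ.reflection x) =
      (3 : ℝ) • (((3 : ℝ) ^ j) • x) - (z : ℝ) • (Real.sqrt 6 • μ) := by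
    rw [reflection_unit_apply hμ, ← hz]
    rw [real_inner_smul_left, real_inner_smul_right, smul_sub, smul_smul, smul_smul, smul_smul, pow_succ]
    congr 1
    · rw [mul_comm]
    · have h' : Real.sqrt 6 * ⟪x, μ⟫_ℝ * Real.sqrt 6 = 6 * ⟪x, μ⟫_ℝ := by
        rw [mul_comm (Real.sqrt 6) _, mul_assoc, h66]; ring
      rw [show (3 : ℝ) ^ j * 3 * (2 * ⟪x, μ⟫_ℝ) = 3 ^ j * (Real.sqrt 6 * ⟪x, μ⟫_ℝ) * Real.sqrt 6 by
        rw [mul_assoc ((3 : ℝ) ^ j) (Real.sqrt 6 * ⟪x, μ⟫_ℝ) (Real.sqrt 6), h']; ring]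
  rw [e]
  have h3 : (3 : ℝ) • (((3 : ℝ) ^ j) • x) ∈ fccStacking 1 (Real.sqrt (2 / 3)) := by
    have := fcc_zsmul_mem 3 hx; push_cast at this; exact this
  exact fcc_sub_zsmul_mem h3 ht z

/-- **Twin-chain lattices are `3⁻ᵏ`-integral**: for a word `κ` of unit model menu normals, `3^(j+|κ|)·(wordFrame 1 κ x) ∈ Λ₀` whenever `3ʲ·x ∈ Λ₀`. -/
theorem three_pow_smul_wordFrame_mem :
    ∀ (κ : List (EuclideanSpace ℝ (Fin 3))),
      (∀ μ ∈ κ, ‖μ‖ = 1 ∧ ∀ w ∈ fccSlots, ⟪w, μ⟫_ℝ = 0 ∨ ⟪w, μ⟫_ℝ = Real.sqrt (2 / 3) ∨ ⟪w, μ⟫_ℝ = -Real.sqrt (2 / 3)) →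
      ∀ {x : EuclideanSpace ℝ (Fin 3)} {j : ℕ}, ((3 : ℝ) ^ j) • x ∈ fccStacking 1 (Real.sqrt (2 / 3)) →
        ((3 : ℝ) ^ (j + κ.length)) • (wordFrame (LinearIsometryEquiv.refl ℝ (EuclideanSpace ℝ (Fin 3))) κ x) ∈
          fccStacking 1 (Real.sqrt (2 / 3))
  | [], _, x, j, hx => by simpa [wordFrame] using hx
  | μ :: κ, hl, x, j, hx => by
    have hμ := hl μ (by simp)
    have hκ : ∀ μ' ∈ κ, ‖μ'‖ = 1 ∧ ∀ w ∈ fccSlots, ⟪w, μ'⟫_ℝ = 0 ∨ ⟪w, μ'⟫_ℝ = Real.sqrt (2 / 3) ∨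
        ⟪w, μ'⟫_ℝ = -Real.sqrt (2 / 3) := fun μ' h => hl μ' (List.mem_cons_of_mem μ h)
    have h1 := three_pow_smul_reflect_mem hμ.1 hμ.2 hx
    have h2 := three_pow_smul_wordFrame_mem κ hκ h1
    rw [wordFrame_cons]
    have e : j + (μ :: κ).length = j + 1 + κ.length := by rw [List.length_cons]; ring
    rw [e]
    exact h2

/-- Version with `x ∈ Λ₀`. -/
theorem three_pow_smul_wordFrame_mem' (κ : List (EuclideanSpace ℝ (Fin 3)))
    (hl : ∀ μ ∈ κ, ‖μ‖ = 1 ∧ ∀ w ∈ fccSlots, ⟪w, μ⟫_ℝ = 0 ∨ ⟪w, μ⟫_ℝ = Real.sqrt (2 / 3) ∨ ⟪w, μ⟫_ℝ = -Real.sqrt (2 / 3))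
    {x : EuclideanSpace ℝ (Fin 3)} (hx : x ∈ fccStacking 1 (Real.sqrt (2 / 3))) :
    ((3 : ℝ) ^ κ.length) • (wordFrame (LinearIsometryEquiv.refl ℝ (EuclideanSpace ℝ (Fin 3))) κ x) ∈
      fccStacking 1 (Real.sqrt (2 / 3)) := by
  have h := three_pow_smul_wordFrame_mem κ hl (x := x) (j := 0) (by simpa using hx)
  simpa using h

/-- **NO TWIST.**  A unit vector `y` of the basal plane with `3ᵏ·y ∈ Λ₀` is in `Λ₀`: writing `3ᵏ y = i u + j v` one has `i² + ij + j² = 9ᵏ`, and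
Eisenstein descent forces `3ᵏ ∣ i`, `3ᵏ ∣ j`. -/
theorem mem_fcc_of_inplane_of_smul_mem {y : EuclideanSpace ℝ (Fin 3)} (k : ℕ)
    (hy : ((3 : ℝ) ^ k) • y ∈ fccStacking 1 (Real.sqrt (2 / 3))) (h2 : y 2 = 0) (hn : ‖y‖ = 1) :
    y ∈ fccStacking 1 (Real.sqrt (2 / 3)) := by
  obtain ⟨k₀, i, j, hp⟩ := mem_barlowStacking_iff.1 hy
  -- the layer index is 0
  have hk₀ : k₀ = 0 := by
    have h := congrArg (fun v : EuclideanSpace ℝ (Fin 3) => v 2) hp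
    simp only [PiLp.smul_apply, smul_eq_mul, h2, mul_zero, barlowPos_apply_two] at h
    have hs : Real.sqrt (2 / 3) ≠ 0 := Real.sqrt_ne_zero'.2 (by norm_num)
    have : (k₀ : ℝ) = 0 := by
      rcases mul_eq_zero.1 h.symm with h' | h'
      · exact h'
      · exact absurd h' hs
    exact_mod_cast this
  subst hk₀
  -- norm identity: 9^k = i² + ij + j²
  have hnorm : ((i ^ 2 + i * j + j ^ 2 : ℤ) : ℝ) = (9 : ℝ) ^ k := by
    have h := norm_sq_barlowPos_fcc 0 i j
    rw [← hp, norm_smul, mul_pow, hn, one_pow, mul_one, Real.norm_eq_abs, abs_of_pos (by positivity)] at h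
    rw [← pow_mul, show k * 2 = 2 * k by ring, pow_mul] at h
    norm_num at h
    push_cast at h ⊢
    linarith
  have hnormZ : i ^ 2 + i * j + j ^ 2 = 9 ^ k := by exact_mod_cast hnorm
  obtain ⟨⟨i', rfl⟩, ⟨j', rfl⟩⟩ := pow_dvd_of_normForm_eq k hnormZ
  -- divide by 3^k
  have h3 : ((3 : ℝ) ^ k) ≠ 0 := pow_ne_zero _ (by norm_num)
  have hy' : y = barlowPos 1 (Real.sqrt (2 / 3)) constHagg 0 i' j' := by
    have e : ((3 : ℝ) ^ k) • y = ((3 : ℝ) ^ k) • barlowPos 1 (Real.sqrt (2 / 3)) constHagg 0 i' j' := by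
      rw [hp, barlowPos_fcc_linear 1 _ 0 (3 ^ k * i') (3 ^ k * j'), barlowPos_fcc_linear 1 _ 0 i' j']
      push_cast
      module
    exact smul_right_injective _ h3 e
  rw [hy']
  exact barlowPos_mem _ _ _

/-- **HEXAGON RIGIDITY (model form).**  For any word `κ` of unit model menu normals of `Λ₀` and any slot `w`: if `wordFrame 1 κ w` lies in the basal
plane, it is a slot of `Λ₀` (one of the six in-plane slots).  So a twin-chain lattice that shares the axis `e₃` has the SAME hexagon as `Λ₀`. -/
theorem wordFrame_inplane_mem_fccSlots (κ : List (EuclideanSpace ℝ (Fin 3)))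
    (hl : ∀ μ ∈ κ, ‖μ‖ = 1 ∧ ∀ w ∈ fccSlots, ⟪w, μ⟫_ℝ = 0 ∨ ⟪w, μ⟫_ℝ = Real.sqrt (2 / 3) ∨ ⟪w, μ⟫_ℝ = -Real.sqrt (2 / 3))
    {w : EuclideanSpace ℝ (Fin 3)} (hw : w ∈ fccSlots)
    (h2 : (wordFrame (LinearIsometryEquiv.refl ℝ (EuclideanSpace ℝ (Fin 3))) κ w) 2 = 0) :
    wordFrame (LinearIsometryEquiv.refl ℝ (EuclideanSpace ℝ (Fin 3))) κ w ∈ fccSlots := by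
  have hn : ‖wordFrame (LinearIsometryEquiv.refl ℝ (EuclideanSpace ℝ (Fin 3))) κ w‖ = 1 := by
    rw [LinearIsometryEquiv.norm_map, norm_eq_one_of_mem_fccSlots hw]
  exact mem_fccSlots_of_unit
    (mem_fcc_of_inplane_of_smul_mem κ.length (three_pow_smul_wordFrame_mem' κ hl (mem_fcc_of_mem_fccSlots hw)) h2 hn) hn

/-- **HEXAGON RIGIDITY over a base frame `B`** (axis `B e₃`): if `⟪wordFrame B κ w, B e₃⟫ = 0` then `B.symm (wordFrame B κ w)` is an in-plane slot of `Λ₀`,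
i.e. `wordFrame B κ w ∈ B '' fccSlots` with zero height in `B`'s coordinates. -/
theorem wordFrame_inplane_mem_image_fccSlots (B : EuclideanSpace ℝ (Fin 3) ≃ₗᵢ[ℝ] EuclideanSpace ℝ (Fin 3))
    (κ : List (EuclideanSpace ℝ (Fin 3)))
    (hl : ∀ μ ∈ κ, ‖μ‖ = 1 ∧ ∀ w ∈ fccSlots, ⟪w, μ⟫_ℝ = 0 ∨ ⟪w, μ⟫_ℝ = Real.sqrt (2 / 3) ∨ ⟪w, μ⟫_ℝ = -Real.sqrt (2 / 3))
    {w : EuclideanSpace ℝ (Fin 3)} (hw : w ∈ fccSlots)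
    (h0 : ⟪wordFrame B κ w, B (EuclideanSpace.single (2 : Fin 3) (1 : ℝ))⟫_ℝ = 0) :
    B.symm (wordFrame B κ w) ∈ fccSlots ∧ (B.symm (wordFrame B κ w)) 2 = 0 := by
  have e : B.symm (wordFrame B κ w) = wordFrame (LinearIsometryEquiv.refl ℝ (EuclideanSpace ℝ (Fin 3))) κ w := by
    rw [wordFrame_apply_eq, LinearIsometryEquiv.symm_apply_apply]
  have h2 : (wordFrame (LinearIsometryEquiv.refl ℝ (EuclideanSpace ℝ (Fin 3))) κ w) 2 = 0 := by
    rw [wordFrame_apply_eq, LinearIsometryEquiv.inner_map_map, EuclideanSpace.inner_single_right] at h0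
    simpa using h0
  rw [e]
  exact ⟨wordFrame_inplane_mem_fccSlots κ hl hw h2, h2⟩

end Summit.Ventures.Crystal3D.Theorems

end
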